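import Mathlib
import Literature.NumberTheory.LFunctions.KloostermanQuadraticTwist
import HarnessLib

/-!
# Kunisky–Yu `T^{4,4,1}`, step 3c: Gershgorin row sums of `T⁽²⁾T⁽²⁾ᵀ` from sums of products of four Kloosterman sums — PROVED (modulo the FKM estimate, taken as a hypothesis)

Topic `Literature/Combinatorics/SimpleGraph` (support for `kuniskyYu2022_theorem_1_2`).
With `K = S(1, ·; p)` and `T⁽²⁾_{r,τ} = K(r²τ) K((1−r)²τ)` (`r, τ ∈ 𝔽_p`), the Gram entries are

  `(T⁽²⁾T⁽²⁾*)_{r,r'} = ∑_τ K(r²τ) K((1−r)²τ) K(r'²τ) K((1−r')²τ)`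

(Kloosterman sums are real).  Kunisky–Yu (133): "by Proposition 4.14 [= Fouvry–Kowalski–Michel
2015, Corollary 3.2], so long as some element among `a², (a+1)², b², (b+1)²` occurs an odd number
of times, the inner sum is `O(p^{5/2})`.  Unconditionally, the inner sum is always `O(p³)`.  For
any particular `a`, there are at most 5 values of `b` … for which all elements occur an even number
of times, so we find `= (2/p)(5p³ + O(p^{7/2})) = O(p^{5/2})`."  We make this quantitative, with the
deep input as an explicit HYPOTHESIS `hFKM` with constant `C ≥ 0` (the `r = 2`, `k = 4`, `h = 0`
case of FKM Cor. 3.2 for the unnormalised `K`: `|∑_{x≠0} K(ax)K(bx)K(cx)K(dx)| ≤ C p^{5/2}` whenever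
`a, b, c, d ≠ 0` are not paired): every absolute row sum is at most
`64 p³ + p + (C + 8) p³ √p` (`paleyT2_gram_rowSum_le`).  Bookkeeping: the trivial bound `16p³`
(`|K| ≤ 2√p`, Weil, PROVED in the tree) for the `≤ 4` exceptional columns `r' ∈ {0, 1, r, 1 − r}`;
`8 p^{5/2}` per entry in the degenerate rows `r ∈ {0, 1}` (where one factor is `K(0) = −1`); and
`1 + C p^{5/2}` for the remaining entries (the `τ = 0` term is `K(0)⁴ = 1`).

## References

* D. Kunisky, X. Yu, arXiv:2211.02713 (2022), Proposition 4.14, Theorem 4.20, (133).  [KuniskyYu2022]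
* É. Fouvry, E. Kowalski, Ph. Michel, *A study in sums of products*, Phil. Trans. R. Soc. A 373
  (2015), 20140309, Corollary 3.2 (arXiv:1405.2293, Cor. 3.3).
-/

noncomputable section

open Finset
open Literature.NumberTheory.LFunctions

namespace Literature.Combinatorics.SimpleGraph

section Rows

variable {p : ℕ} [hp : Fact p.Prime]

/-- `‖K(a) K(b)‖ ≤ 4p` and friends: the product of `m` Kloosterman sums has norm `≤ (2√p)^m`;
here the four-fold product, `≤ 16 p²`. [folklore] -/
theorem norm_kloosterman_prod_four_le (a b c d : ZMod p) :
    ‖kloostermanSum p 1 a * kloostermanSum p 1 b * kloostermanSum p 1 c * kloostermanSum p 1 d‖ ≤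
      16 * (p : ℝ) ^ 2 := by
  have hs : Real.sqrt p ^ 2 = p := Real.sq_sqrt (Nat.cast_nonneg p)
  have h0 : 0 ≤ Real.sqrt p := Real.sqrt_nonneg p
  have ha := norm_kloostermanSum_one_prime_le (p := p) a
  have hb := norm_kloostermanSum_one_prime_le (p := p) b
  have hc := norm_kloostermanSum_one_prime_le (p := p) c
  have hd := norm_kloostermanSum_one_prime_le (p := p) d
  rw [norm_mul, norm_mul, norm_mul]
  calc ‖kloostermanSum p 1 a‖ * ‖kloostermanSum p 1 b‖ * ‖kloostermanSum p 1 c‖ *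
        ‖kloostermanSum p 1 d‖ ≤ (2 * Real.sqrt p) * (2 * Real.sqrt p) * (2 * Real.sqrt p) *
        (2 * Real.sqrt p) := by
        gcongr
    _ = 16 * (Real.sqrt p ^ 2) ^ 2 := by ring
    _ = 16 * (p : ℝ) ^ 2 := by rw [hs]

/-- With one factor `K(0) = −1`: `‖K(0) K(b) K(c) K(d)‖ ≤ 8 p √p`. [folklore] -/
theorem norm_kloosterman_zero_prod_three_le (b c d : ZMod p) :
    ‖kloostermanSum p 1 0 * kloostermanSum p 1 b * kloostermanSum p 1 c * kloostermanSum p 1 d‖ ≤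
      8 * ((p : ℝ) * Real.sqrt p) := by
  have hs : Real.sqrt p ^ 2 = p := Real.sq_sqrt (Nat.cast_nonneg p)
  have h0 : 0 ≤ Real.sqrt p := Real.sqrt_nonneg p
  have hb := norm_kloostermanSum_one_prime_le (p := p) b
  have hc := norm_kloostermanSum_one_prime_le (p := p) c
  have hd := norm_kloostermanSum_one_prime_le (p := p) d
  rw [norm_mul, norm_mul, norm_mul, kloostermanSum_one_zero, norm_neg, norm_one, one_mul]
  calc ‖kloostermanSum p 1 b‖ * ‖kloostermanSum p 1 c‖ * ‖kloostermanSum p 1 d‖ ≤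
        (2 * Real.sqrt p) * (2 * Real.sqrt p) * (2 * Real.sqrt p) := by
        gcongr
    _ = 8 * (Real.sqrt p ^ 2 * Real.sqrt p) := by ring
    _ = 8 * ((p : ℝ) * Real.sqrt p) := by rw [hs]

/-- The Gram entry of `T⁽²⁾` as a single sum of four-fold Kloosterman products (Kloosterman sums
are real). [cite: KuniskyYu2022, Theorem 4.20 (133)] -/
theorem paleyT2_gram_entry_eq (r r' : ZMod p) :
    ∑ τ : ZMod p, (kloostermanSum p 1 (r ^ 2 * τ) * kloostermanSum p 1 ((1 - r) ^ 2 * τ)) *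
        (starRingEnd ℂ) (kloostermanSum p 1 (r' ^ 2 * τ) * kloostermanSum p 1 ((1 - r') ^ 2 * τ)) =
      ∑ τ : ZMod p, kloostermanSum p 1 (r ^ 2 * τ) * kloostermanSum p 1 ((1 - r) ^ 2 * τ) *
        kloostermanSum p 1 (r' ^ 2 * τ) * kloostermanSum p 1 ((1 - r') ^ 2 * τ) := by
  refine Finset.sum_congr rfl fun τ _ => ?_
  rw [map_mul, conj_kloostermanSum_one, conj_kloostermanSum_one]
  ring

/-- **Trivial bound** for a Gram entry: `≤ 16 p³`. [cite: KuniskyYu2022, Theorem 4.20 (133)] -/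
theorem norm_paleyT2_gram_entry_le_trivial (r r' : ZMod p) :
    ‖∑ τ : ZMod p, (kloostermanSum p 1 (r ^ 2 * τ) * kloostermanSum p 1 ((1 - r) ^ 2 * τ)) *
        (starRingEnd ℂ) (kloostermanSum p 1 (r' ^ 2 * τ) *
          kloostermanSum p 1 ((1 - r') ^ 2 * τ))‖ ≤ 16 * (p : ℝ) ^ 3 := by
  rw [paleyT2_gram_entry_eq]
  calc _ ≤ ∑ _τ : ZMod p, (16 : ℝ) * (p : ℝ) ^ 2 :=
        (norm_sum_le _ _).trans (Finset.sum_le_sum fun τ _ => norm_kloosterman_prod_four_le _ _ _ _)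
    _ = 16 * (p : ℝ) ^ 3 := by
        rw [Finset.sum_const, Finset.card_univ, ZMod.card, nsmul_eq_mul]
        ring

/-- **Degenerate rows** `r ∈ {0, 1}` (one factor is `K(0) = −1`): every entry is `≤ 8 p^{5/2}`.
[cite: KuniskyYu2022, Theorem 4.20 (133)] -/
theorem norm_paleyT2_gram_entry_le_of_degenerate {r : ZMod p} (hr : r = 0 ∨ r = 1) (r' : ZMod p) :
    ‖∑ τ : ZMod p, (kloostermanSum p 1 (r ^ 2 * τ) * kloostermanSum p 1 ((1 - r) ^ 2 * τ)) *
        (starRingEnd ℂ) (kloostermanSum p 1 (r' ^ 2 * τ) *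
          kloostermanSum p 1 ((1 - r') ^ 2 * τ))‖ ≤ 8 * ((p : ℝ) ^ 2 * Real.sqrt p) := by
  rw [paleyT2_gram_entry_eq]
  have hterm : ∀ τ : ZMod p, ‖kloostermanSum p 1 (r ^ 2 * τ) *
      kloostermanSum p 1 ((1 - r) ^ 2 * τ) * kloostermanSum p 1 (r' ^ 2 * τ) *
      kloostermanSum p 1 ((1 - r') ^ 2 * τ)‖ ≤ 8 * ((p : ℝ) * Real.sqrt p) := by
    intro τ
    rcases hr with h | h
    · subst h
      have e : (0 : ZMod p) ^ 2 * τ = 0 := by ring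
      rw [e]
      exact norm_kloosterman_zero_prod_three_le _ _ _
    · subst h
      have e : (1 - 1 : ZMod p) ^ 2 * τ = 0 := by ring
      rw [e, show kloostermanSum p 1 (1 ^ 2 * τ) * kloostermanSum p 1 0 *
          kloostermanSum p 1 (r' ^ 2 * τ) * kloostermanSum p 1 ((1 - r') ^ 2 * τ) =
        kloostermanSum p 1 0 * kloostermanSum p 1 (1 ^ 2 * τ) *
          kloostermanSum p 1 (r' ^ 2 * τ) * kloostermanSum p 1 ((1 - r') ^ 2 * τ) by ring]
      exact norm_kloosterman_zero_prod_three_le _ _ _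
  calc _ ≤ ∑ _τ : ZMod p, (8 : ℝ) * ((p : ℝ) * Real.sqrt p) :=
        (norm_sum_le _ _).trans (Finset.sum_le_sum fun τ _ => hterm τ)
    _ = 8 * ((p : ℝ) ^ 2 * Real.sqrt p) := by
        rw [Finset.sum_const, Finset.card_univ, ZMod.card, nsmul_eq_mul]
        ring

/-- In `𝔽_p`, `p` odd: if `r' ∉ {r, 1 − r}` then the multiset `{r², (1−r)², r'², (1−r')²}` is
not a union of two equal pairs (Kunisky–Yu (133): "there are at most 5 values of `b` … for which
all elements occur an even number of times"). [cite: KuniskyYu2022, Theorem 4.20 (133)] -/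
theorem not_paired_of_generic (hp2 : p ≠ 2) {r r' : ZMod p} (hrr : r' ≠ r) (hrr' : r' ≠ 1 - r) :
    ¬ ((r ^ 2 = (1 - r) ^ 2 ∧ r' ^ 2 = (1 - r') ^ 2) ∨
        (r ^ 2 = r' ^ 2 ∧ (1 - r) ^ 2 = (1 - r') ^ 2) ∨
        (r ^ 2 = (1 - r') ^ 2 ∧ (1 - r) ^ 2 = r' ^ 2)) := by
  have hF : ringChar (ZMod p) ≠ 2 := by rwa [ZMod.ringChar_zmod_n]
  have h2 : (2 : ZMod p) ≠ 0 := Ring.two_ne_zero hF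
  rintro (⟨h1, h2'⟩ | ⟨h1, h2'⟩ | ⟨h1, h2'⟩)
  · -- `r = 1/2 = r'`
    apply hrr
    have e1 : 2 * r = 1 := by
      have := sub_eq_zero.mpr h1
      have h3 : r ^ 2 - (1 - r) ^ 2 = 2 * r - 1 := by ring
      rw [h3] at this
      exact (sub_eq_zero.mp this)
    have e2 : 2 * r' = 1 := by
      have := sub_eq_zero.mpr h2'
      have h3 : r' ^ 2 - (1 - r') ^ 2 = 2 * r' - 1 := by ring
      rw [h3] at this
      exact (sub_eq_zero.mp this)
    have : 2 * r' = 2 * r := by rw [e1, e2]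
    exact mul_left_cancel₀ h2 this
  · rcases sq_eq_sq_iff_eq_or_eq_neg.mp h1 with h | h
    · exact hrr h.symm
    · rcases sq_eq_sq_iff_eq_or_eq_neg.mp h2' with h' | h'
      · exact hrr (by linear_combination h')
      · exact h2 (by linear_combination h' + h)
  · rcases sq_eq_sq_iff_eq_or_eq_neg.mp h1 with h | h
    · exact hrr' (by linear_combination h)
    · rcases sq_eq_sq_iff_eq_or_eq_neg.mp h2' with h' | h'
      · exact hrr' (by linear_combination -h')
      · exact h2 (by linear_combination h + h')

/-- **Generic entries** via the Fouvry–Kowalski–Michel hypothesis: for `r ∉ {0,1}`,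
`r' ∉ {0, 1, r, 1 − r}`, `|(T⁽²⁾T⁽²⁾*)_{r,r'}| ≤ 1 + C p^{5/2}`. [cite: KuniskyYu2022, Theorem 4.20 (133)] -/
theorem norm_paleyT2_gram_entry_le_of_generic (hp2 : p ≠ 2) {C : ℝ}
    (hFKM : ∀ a b c d : ZMod p, a ≠ 0 → b ≠ 0 → c ≠ 0 → d ≠ 0 →
      ¬ ((a = b ∧ c = d) ∨ (a = c ∧ b = d) ∨ (a = d ∧ b = c)) →
      ‖∑ x ∈ (Finset.univ : Finset (ZMod p)).erase 0,
          kloostermanSum p 1 (a * x) * kloostermanSum p 1 (b * x) *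
            kloostermanSum p 1 (c * x) * kloostermanSum p 1 (d * x)‖ ≤
        C * ((p : ℝ) ^ 2 * Real.sqrt p))
    {r r' : ZMod p} (hr0 : r ≠ 0) (hr1 : r ≠ 1) (hr'0 : r' ≠ 0) (hr'1 : r' ≠ 1) (hrr : r' ≠ r)
    (hrr' : r' ≠ 1 - r) :
    ‖∑ τ : ZMod p, (kloostermanSum p 1 (r ^ 2 * τ) * kloostermanSum p 1 ((1 - r) ^ 2 * τ)) *
        (starRingEnd ℂ) (kloostermanSum p 1 (r' ^ 2 * τ) *
          kloostermanSum p 1 ((1 - r') ^ 2 * τ))‖ ≤ 1 + C * ((p : ℝ) ^ 2 * Real.sqrt p) := by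
  classical
  rw [paleyT2_gram_entry_eq, ← Finset.add_sum_erase Finset.univ _ (Finset.mem_univ (0 : ZMod p))]
  have h0 : kloostermanSum p 1 (r ^ 2 * 0) * kloostermanSum p 1 ((1 - r) ^ 2 * 0) *
      kloostermanSum p 1 (r' ^ 2 * 0) * kloostermanSum p 1 ((1 - r') ^ 2 * 0) = 1 := by
    simp only [mul_zero, kloostermanSum_one_zero]
    norm_num
  rw [h0]
  have ha : r ^ 2 ≠ 0 := pow_ne_zero 2 hr0
  have hb : (1 - r) ^ 2 ≠ 0 := pow_ne_zero 2 (sub_ne_zero.mpr (Ne.symm hr1))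
  have hc : r' ^ 2 ≠ 0 := pow_ne_zero 2 hr'0
  have hd : (1 - r') ^ 2 ≠ 0 := pow_ne_zero 2 (sub_ne_zero.mpr (Ne.symm hr'1))
  have h := hFKM (r ^ 2) ((1 - r) ^ 2) (r' ^ 2) ((1 - r') ^ 2) ha hb hc hd
    (not_paired_of_generic hp2 hrr hrr')
  calc _ ≤ ‖(1 : ℂ)‖ + ‖∑ x ∈ (Finset.univ : Finset (ZMod p)).erase 0,
          kloostermanSum p 1 (r ^ 2 * x) * kloostermanSum p 1 ((1 - r) ^ 2 * x) *
            kloostermanSum p 1 (r' ^ 2 * x) * kloostermanSum p 1 ((1 - r') ^ 2 * x)‖ :=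
        norm_add_le _ _
    _ ≤ 1 + C * ((p : ℝ) ^ 2 * Real.sqrt p) := by
        rw [norm_one]
        linarith

/-- **Row sums of `T⁽²⁾T⁽²⁾*`** (Kunisky–Yu (133): "`max_a ∑_b |(T⁽²⁾T⁽²⁾ᵀ)_{ab}| = 5p³ + O(p^{7/2})`",
here with explicit constants and the FKM estimate as hypothesis `hFKM`, `C ≥ 0`): every absolute
row sum is at most `64 p³ + p + (C + 8) p³ √p`. [cite: KuniskyYu2022, Theorem 4.20] -/
theorem paleyT2_gram_rowSum_le (hp2 : p ≠ 2) {C : ℝ} (hC : 0 ≤ C)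
    (hFKM : ∀ a b c d : ZMod p, a ≠ 0 → b ≠ 0 → c ≠ 0 → d ≠ 0 →
      ¬ ((a = b ∧ c = d) ∨ (a = c ∧ b = d) ∨ (a = d ∧ b = c)) →
      ‖∑ x ∈ (Finset.univ : Finset (ZMod p)).erase 0,
          kloostermanSum p 1 (a * x) * kloostermanSum p 1 (b * x) *
            kloostermanSum p 1 (c * x) * kloostermanSum p 1 (d * x)‖ ≤
        C * ((p : ℝ) ^ 2 * Real.sqrt p))
    (r : ZMod p) :
    ∑ r' : ZMod p, ‖∑ τ : ZMod p,
        (kloostermanSum p 1 (r ^ 2 * τ) * kloostermanSum p 1 ((1 - r) ^ 2 * τ)) *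
        (starRingEnd ℂ) (kloostermanSum p 1 (r' ^ 2 * τ) *
          kloostermanSum p 1 ((1 - r') ^ 2 * τ))‖ ≤
      64 * (p : ℝ) ^ 3 + p + (C + 8) * ((p : ℝ) ^ 3 * Real.sqrt p) := by
  classical
  have hp0 : (0 : ℝ) ≤ p := Nat.cast_nonneg p
  have hs0 : (0 : ℝ) ≤ Real.sqrt p := Real.sqrt_nonneg p
  have hcardR : ((Finset.univ : Finset (ZMod p)).card : ℝ) = p := by
    rw [Finset.card_univ, ZMod.card]
  by_cases hdeg : r = 0 ∨ r = 1
  · -- degenerate row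
    calc _ ≤ ∑ _r' : ZMod p, (8 : ℝ) * ((p : ℝ) ^ 2 * Real.sqrt p) :=
          Finset.sum_le_sum fun r' _ => norm_paleyT2_gram_entry_le_of_degenerate hdeg r'
      _ = 8 * ((p : ℝ) ^ 3 * Real.sqrt p) := by
          rw [Finset.sum_const, Finset.card_univ, ZMod.card, nsmul_eq_mul]
          ring
      _ ≤ _ := by nlinarith [mul_nonneg (pow_nonneg hp0 3) hs0, pow_nonneg hp0 3]
  · have hr0 : r ≠ 0 := fun h => hdeg (Or.inl h)
    have hr1 : r ≠ 1 := fun h => hdeg (Or.inr h)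
    -- exceptional columns
    set S : Finset (ZMod p) := {0, 1, r, 1 - r} with hS
    have hScard : S.card ≤ 4 := by
      rw [hS]
      refine (Finset.card_insert_le _ _).trans ?_
      refine (Nat.succ_le_succ (Finset.card_insert_le _ _)).trans ?_
      refine (Nat.succ_le_succ (Nat.succ_le_succ (Finset.card_insert_le _ _))).trans ?_
      rw [Finset.card_singleton]
    set g : ZMod p → ℝ := fun r' => if r' ∈ S then 16 * (p : ℝ) ^ 3
      else 1 + C * ((p : ℝ) ^ 2 * Real.sqrt p) with hg
    have hle : ∀ r' : ZMod p, ‖∑ τ : ZMod p,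
        (kloostermanSum p 1 (r ^ 2 * τ) * kloostermanSum p 1 ((1 - r) ^ 2 * τ)) *
        (starRingEnd ℂ) (kloostermanSum p 1 (r' ^ 2 * τ) *
          kloostermanSum p 1 ((1 - r') ^ 2 * τ))‖ ≤ g r' := by
      intro r'
      rw [hg]
      by_cases hmem : r' ∈ S
      · simp only [hmem, if_true]
        exact norm_paleyT2_gram_entry_le_trivial r r'
      · simp only [hmem, if_false]
        rw [hS] at hmem
        simp only [Finset.mem_insert, Finset.mem_singleton, not_or] at hmem
        obtain ⟨h0', h1', hr', hr''⟩ := hmem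
        exact norm_paleyT2_gram_entry_le_of_generic hp2 hFKM hr0 hr1 h0' h1' hr' hr''
    refine (Finset.sum_le_sum fun r' _ => hle r').trans ?_
    rw [hg, Finset.sum_ite, Finset.sum_const, Finset.sum_const, nsmul_eq_mul, nsmul_eq_mul]
    have hc1 : ((Finset.univ.filter fun r' : ZMod p => r' ∈ S).card : ℝ) ≤ 4 := by
      have : (Finset.univ.filter fun r' : ZMod p => r' ∈ S) ⊆ S := by
        intro x hx
        exact (Finset.mem_filter.mp hx).2
      exact_mod_cast (Finset.card_le_card this).trans hScard
    have hc2 : ((Finset.univ.filter fun r' : ZMod p => ¬ r' ∈ S).card : ℝ) ≤ p := by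
      rw [← hcardR]
      exact_mod_cast Finset.card_filter_le _ _
    have hA : 0 ≤ 16 * (p : ℝ) ^ 3 := by positivity
    have hB : 0 ≤ 1 + C * ((p : ℝ) ^ 2 * Real.sqrt p) := by positivity
    calc ((Finset.univ.filter fun r' : ZMod p => r' ∈ S).card : ℝ) * (16 * (p : ℝ) ^ 3) +
          ((Finset.univ.filter fun r' : ZMod p => ¬ r' ∈ S).card : ℝ) *
            (1 + C * ((p : ℝ) ^ 2 * Real.sqrt p))
        ≤ 4 * (16 * (p : ℝ) ^ 3) + (p : ℝ) * (1 + C * ((p : ℝ) ^ 2 * Real.sqrt p)) :=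
          add_le_add (mul_le_mul_of_nonneg_right hc1 hA) (mul_le_mul_of_nonneg_right hc2 hB)
      _ = 64 * (p : ℝ) ^ 3 + p + C * ((p : ℝ) ^ 3 * Real.sqrt p) := by ring
      _ ≤ 64 * (p : ℝ) ^ 3 + p + (C + 8) * ((p : ℝ) ^ 3 * Real.sqrt p) := by
          nlinarith [mul_nonneg (pow_nonneg hp0 3) hs0]

end Rows

end Literature.Combinatorics.SimpleGraph

end
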